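import Literature.AlgebraicGeometry.Markman2025.SecantQuotientCarrier
import Literature.AlgebraicGeometry.Motives.AbelianVarietyCohomologyExteriorH1
import Literature.AlgebraicGeometry.Motives.AbelianVarietyProductDimProofs
import Literature.AlgebraicGeometry.HodgeTheory.AbelianVarietyEndomorphismsHOne
import Literature.AlgebraicGeometry.HodgeTheory.LefschetzOneOneHolds
import Literature.AlgebraicGeometry.HodgeTheory.IsoTransport
import Literature.AlgebraicGeometry.Motives.AbelianVarietyIsoOfScheme
import Literature.AlgebraicGeometry.Motives.CurveNet
import Literature.AlgebraicGeometry.HodgeTheory.AmpleDivisorChernClassNeZero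
import HarnessLib

/-!
# Markman's Weil polarisation `Ξ = p₁^*θ + d·p₂^*θ̂` on `X × X̂` in closed form, `φ_d^*Ξ = d·Ξ`, and its
# descent `h_Y` to the secant quotient `Y = (X × X̂)/Ḡ` — REAL carriers (arXiv:2502.03415 §3.2, §1.5)

Layer `Literature/AlgebraicGeometry/Markman2025`, namespace `Literature.AlgebraicGeometry.Markman2025` (+ a dot-notation
extension of `Motives.AbelianVariety` in §1 and two pull-back lemmas in `HodgeTheory`, §0). Typer seat `hodge-lit-avcarriers`
(cell `pub-hodge-ring2`), second instalment of ask `LEAD/ASK#carriers-secant-anchor` item (d) "the quotient `Y_d = (X × X̂)/Ḡ`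
WITH ITS DESCENDED POLARISATION `h_Y`" (ring2 INBOX l.4943), on top of the carrier file `Markman2025/SecantQuotientCarrier`
(`rouquierImage = Ḡ`, `secantQuotient = Y`, `secantQuotientMap = q`, `weilOperator = φ_d`). As there, everything lives on
the tree's REAL carriers (`Motives.AbelianVariety ℂ`, `A.dualOf Θ`, `complexBetti`) and NOTHING asserts a statement of the
preprint: every declaration is a definition with a body or a proved lemma; the preprint is cited for the SHAPE of the objects
(which class is Markman's `Ξ_P`, which is `h`).

## Source, verbatim (E. Markman, *Cycles on abelian 2n-folds of Weil type from secant sheaves on abelian n-folds*,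
## arXiv:2502.03415v2, UNREFEREED; held text `paper:arxiv-2502.03415`) [Markman2025SecantWeil]

§3.1–3.2 (pp. 14–16; `V = H¹(X, ℤ) ⊕ H¹(X̂, ℤ)` with its symmetric pairing `(•,•)_V`, `f := η(√-d)`, "`(f(x), f(y))_V =
d(x, y)_V`, and `f² = -d` […] and so `f` is anti-self-dual"): "Let `Ξ_P ∈ ∧²V_ℚ^*` be the 2-form **`Ξ_P(x, y) := (f(x), y)_V`.**
The 2-form `Ξ_P` is non-degenerate, since `f` is invertible and the pairing on `V` is non-degenerate." Cor. 3.2.3: "If the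
bilinear form `g_I` is positive definite, then the rational `(1,1)` class `Ξ_P(x, y)` is a Kähler class, and so the complex
torus `(V_ℝ/V_ℤ, I, Ξ_P)` is a polarized abelian variety of Weil type. Proof. […] **`f^*Ξ_P(x, y) := Ξ_P(f(x), f(y)) =
(f²(x), f(y))_V = -(f³(x), y)_V = d(f(x), y) = dΞ_P(x, y)`, verifying the condition on the polarization in [van-Geemen].**"
§1.3 (p. 5): "`(X × X̂, η, h)` is a polarized abelian variety of Weil type"; §1.5 (p. 7): "Let `q : X × X̂ → Y := (X × X̂)/Ḡ`
be the quotient morphism […] The morphism `q` induces a local isomorphism of the Kuranishi deformation spaces of `X × X̂` and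
`Y`"; proof of Lemma 9.3.11 (p. 74): "the arrows labeled `q^*` are all isomorphisms". The tree's
`HodgeTheory/WeilClassesLocalAnchor` (witness paragraph) fixes `η(√-d) = φ_d : (x, y) ↦ (-d θ⁻¹ y, θ x)` on `X × X̂`,
`θ = φ_Θ` the principal polarisation — the tree's `Markman2025.weilOperator`.

## The computation behind the closed form (rendering; standard, not a sentence of the preprint)

Write `Λ = H₁(X, ℤ)`, `H₁(X̂, ℤ) = Λ^*`, so `H₁(X × X̂) = Λ ⊕ Λ^*` and `(•,•)_V` is the evaluation pairing; let
`E ∈ Alt²(Λ) = H²(X)` be the class `θ` of `Θ` and `ε = H₁(φ_Θ) : Λ ⥲ Λ^*`, `u ↦ E(u, •)` (principal `Θ`), so that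
`H₁(φ_d)(u, λ) = (-d ε⁻¹λ, ε u)`. Then `Ξ_P((u, λ), (u', λ')) = ((-d ε⁻¹λ, ε u), (u', λ'))_V = E(u, u') - d·λ'(ε⁻¹λ) =
E(u, u') + d·E(ε⁻¹λ, ε⁻¹λ')`, i.e. **`Ξ_P = p₁^*θ + d·p₂^*θ̂` with `θ̂ := (φ_Θ⁻¹)^*θ` the class on `X̂` pulling back to `θ`**
(the cross terms vanish; the overall sign depends on the convention `V ≅ V^*`, immaterial for the consumers, which read `h`
up to `ℚˣ`). This file DEFINES `Ξ` by the right-hand side on the real carrier and PROVES Markman's displayed identity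
`f^*Ξ = dΞ` for it (`complexBetti_map_weilOperator_weilPolarizationClass`), using only `[m]^* = mᵏ` on `Hᵏ` and functoriality.

## What is typed (definitions with bodies / proved lemmas; NO named fact, no instance, no notation)

§0 (`HodgeTheory`): `(n • f)^* = nᵏ·f^*` (and `(-f)^* = (-1)ᵏf^*`) on `Hᵏ(–(ℂ); ℂ)` for homomorphisms of complex abelian
varieties and `n : ℤ` (Mumford §19; the tree had `n ∈ ℕ` with `f = 𝟙`, `complexBetti_map_nsmul_id_apply`).
§1 (`Motives.AbelianVariety`, `Θ` ample): `A.dualClassOf hΘ θ` — **`θ̂`, the class on `Â = A/K(Θ)` with `φ_Θ^*θ̂ = θ`** (`φ_Θ^*`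
is bijective); linear in `θ`, rational `(p,p)` iff `θ` is, `= (φ_Θ⁻¹)^*θ` for `Θ` principal.
§2 (`Markman2025`): `weilPolarizationClass A hΘ d θ := p₁^*θ + d·p₂^*θ̂ ∈ H²((A × Â)(ℂ); ℂ)` — **Markman's `Ξ_P` for
`η(√-d) = φ_d`**; PROVED: `ℚ`-linearity, non-vanishing (`θ ≠ 0 ⟹ Ξ ≠ 0`, restriction to `A × 0`), rationality, Hodge type
`(1,1)` and algebraicity (`∈ N¹H²`, Lefschetz `(1,1)` in the tree) whenever `θ` is rational of type `(1,1)`, and **`φ_d^*Ξ = d·Ξ`**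
(Cor. 3.2.3, van Geemen's condition on the polarisation of an abelian variety of Weil type).
§3 (`Markman2025`, `G₁, G₂ ≤ A[n](ℂ)`): `secantPolarizationClass … d θ ∈ H²(Y(ℂ); ℂ)` — **`h_Y`, the DESCENT of `Ξ` to
`Y = (A × Â)/Ḡ`: the unique class with `q^*h_Y = Ξ`** (`q^*` bijective, `SecantQuotientCarrier`); PROVED: uniqueness, linearity,
non-vanishing, rationality / `(1,1)` / algebraicity from `θ`, and — for a quasi-inverse `r` of `q` (`q ≫ r = n`) — the descended
operator `ψ_Y := r ≫ φ_d ≫ q` satisfies `ψ_Y ≫ ψ_Y = -(n²d)` and **`ψ_Y^*h_Y = (n²d)·h_Y`** (the Weil-type condition on `Y`,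
same field `ℚ(√-d)`); `dim Y = 2·dim A` without the `dim_prod` binder of the carrier file.
§4 the anchor envelope WITH ITS CLASS, at SCHEME level (the signature `𝔄 X θ` of the ring-2 anchor predicates):
`IsSecantQuotientAnchorWith d X θ_X` — a chart `e : X ≅ ((J × Ĵ)/Ḡ)` over the binders of `IsSecantQuotientSixfold` AND
`θ_X = e^*h_Y(θ)` for `θ` a polarisation class of the Riemann theta divisor `Θ` (`AbelianVariety.IsPolarizationClassOf`, i.e.
`θ ∈ ℚˣ·[Θ]`); PROVED: introduction rule, transport along isomorphisms `X' ≅ X`, it refines `IsSecantQuotientSixfold` (for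
`X = Y.X`, Milne 1986 Rem. 2.3), and `θ_X` is rational, non-zero, of type `(1,1)` in dimension `6` and algebraic. HONEST SCOPE (as in the carrier file): "generic non-hyperelliptic
`C`", Lemma 9.3.1's general position and the parity of `d` are NOT inside (conjoin `TranslatesInGeneralPosition`, `Even d`);
the hard Lefschetz property / ampleness of `h_Y` and the hyperbolicity `det H = (-1)³` (Lemma 3.1.3) are NOT proved here
(no Künneth–`sl₂` for `p₁^*θ + d·p₂^*θ̂` on the real carrier); `θ` is pinned to `[Θ]` only up to `ℚˣ` (LIMIT 1 of the seat's
name table: the tree's `c₁` is normalised up to a scalar).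
§5 (appended, seat gen 3): **the envelope WITH class is inhabited over the envelope** — since every ample divisor on a complex
abelian variety of positive dimension HAS a polarisation class (`HodgeTheory/AmpleDivisorChernClassNeZero`:
`AbelianVariety.exists_isPolarizationClassOf_of_isAmple`, `c₁(𝒪(Θ)) ≠ 0`), `IsSecantQuotientSixfold d Y ⟺ ∃ θ_Y,
IsSecantQuotientAnchorWith d Y.X θ_Y`, and every secant quotient `(J × Ĵ)/Ḡ` built from a Riemann principal `Θ` carries
`h_Y(θ₀)` for some `θ₀ ∈ ℚˣ·[Θ]` at the identity chart (`exists_isPolarizationClassOf_isSecantQuotientAnchorWith_secantQuotient`).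

## References
* [Markman2025SecantWeil] E. Markman, arXiv:2502.03415v2 (2025), §1.3 (p. 5), §1.5 (p. 7), §3.1–3.2 (pp. 14–16: `Ξ_P`,
  Cor. 3.2.3), Lemma 3.1.3, §9.3 (proof of Lemma 9.3.11: `q^*` isomorphisms). UNREFEREED PREPRINT — cited for the shape only.
* [vanGeemen1994HodgeAV] B. van Geemen, *An introduction to the Hodge conjecture for abelian varieties*, LNM 1594 (1994),
  5.2 (polarised abelian varieties of Weil type: `E(kx, ky) = Nm(k)E(x, y)`), §3.6 (isogenies on `Bᵖ`).
* [MumfordAV1970] D. Mumford, *Abelian Varieties* (1970), §1 (3) and §19 (`[n]^* = nᵏ` on `Hᵏ`; quasi-inverse of an isogeny).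
* [Lange2023AbelianVarietiesComplex] H. Lange, *Abelian Varieties over the Complex Numbers* (2023), §1.4.2, §2.1.1, §5.2.1
  (polarised abelian varieties of Weil type), Cor. 2.1.8.
* [VoisinHodgeI2002] C. Voisin, *Hodge Theory and Complex Algebraic Geometry I*, Thm. 11.33, §7.1 (Lefschetz `(1,1)`).
* Tree: `Markman2025/SecantQuotientCarrier`, `Motives/AbelianVarietyDualQuotient`, `Motives/AbelianVarietyPrincipalPolarization`,
  `Motives/JacobianThetaDivisor` (seat `hodge-lit-avcarriers`), `HodgeTheory/AbelianVarietyMultiplicationPullback`,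
  `HodgeTheory/AbelianVarietyEndomorphismsHOne`, `HodgeTheory/LefschetzOneOneHolds`.
-/

noncomputable section

universe u

open CategoryTheory AlgebraicGeometry

/-! ## §0 `(n • f)^* = nᵏ · f^*` on `Hᵏ` for homomorphisms of complex abelian varieties, `n : ℤ` -/

namespace Literature.AlgebraicGeometry.HodgeTheory

open Literature.AlgebraicTopology.SingularHomology Literature.AlgebraicGeometry.Motives

variable {A B C : AbelianVariety ℂ}

/-- `(f ≫ g)^* c = f^*(g^* c)` on elements of `Hᵏ(–(ℂ); ℂ)` for homomorphisms of abelian varieties (functoriality of the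
induced homomorphisms, `(fg)^* = g^*f^*`). [cite: HatcherAT2002, §3.1 (p. 201: induced homomorphisms, (fg)^* = g^* f^*)] -/
theorem complexBetti_map_comp_hom_apply (f : A ⟶ B) (g : B ⟶ C) (k : ℕ) (c : complexBetti C.X k) :
    complexBetti.map (f ≫ g).hom.hom.hom k c = complexBetti.map f.hom.hom.hom k (complexBetti.map g.hom.hom.hom k c) := by
  change complexBetti.map (f.hom.hom.hom ≫ g.hom.hom.hom) k c = _
  rw [complexBetti.map_comp, ModuleCat.comp_apply]

/-- `𝟙^* c = c` on elements of `Hᵏ(A(ℂ); ℂ)` (`𝟙^* = 𝟙`). [cite: HatcherAT2002, §3.1 (p. 201: induced homomorphisms, 𝟙^* = 𝟙)] -/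
theorem complexBetti_map_id_hom_apply (k : ℕ) (c : complexBetti A.X k) :
    complexBetti.map (𝟙 A : A ⟶ A).hom.hom.hom k c = c := by
  change complexBetti.map (𝟙 A.X) k c = c
  rw [complexBetti.map_id]
  rfl

/-- **`(n • f)^* = nᵏ · f^*` on `Hᵏ(B(ℂ); ℂ)`** for a homomorphism `f : A ⟶ B` of complex abelian varieties and `n : ℤ`
(Mumford §19 / §1 (3): `Hᵏ = ⋀ᵏH¹` and `(n • f)^* = n·f^*` on `H¹`): `Hᵏ` is spanned by cup products of degree-one classes
(`AbelianVariety.hasExteriorCohomologyH1_complexPoints`), on which both sides are computed factorwise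
(`complexBetti_map_cupPowOne`, `complexBetti_map_zsmul_one`). The tree's `complexBetti_map_nsmul_id_apply` is the case
`f = 𝟙`, `n ∈ ℕ`. [cite: MumfordAV1970, §1 (3) and §19] -/
theorem complexBetti_map_zsmul_hom_apply_eq_pow_smul (n : ℤ) (f : A ⟶ B) (k : ℕ) (y : complexBetti B.X k) :
    complexBetti.map (n • f).hom.hom.hom k y = ((n : ℂ) ^ k) • complexBetti.map f.hom.hom.hom k y := by
  -- both sides agree on the spanning products of `H¹`-classes
  have key : ∀ v : Fin k → complexBetti B.X 1,
      complexBetti.map (n • f).hom.hom.hom k (cupPowOne ℂ (ComplexPoints B.X) k v) =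
        ((n : ℂ) ^ k) • complexBetti.map f.hom.hom.hom k (cupPowOne ℂ (ComplexPoints B.X) k v) := by
    intro v
    rw [complexBetti_map_cupPowOne, complexBetti_map_cupPowOne]
    have hv : (fun i => complexBetti.map (n • f).hom.hom.hom 1 (v i)) =
        fun i => (n : ℂ) • complexBetti.map f.hom.hom.hom 1 (v i) := by
      funext i
      rw [complexBetti_map_zsmul_one]
      change (n • complexBetti.map f.hom.hom.hom 1).hom (v i) = _
      rw [ModuleCat.hom_zsmul, LinearMap.smul_apply, Int.cast_smul_eq_zsmul]
    rw [hv, MultilinearMap.map_smul_univ, Finset.prod_const, Finset.card_univ, Fintype.card_fin]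
  have hspan := (AbelianVariety.hasExteriorCohomologyH1_complexPoints B).span_range_cupPowOne k
  have hy : y ∈ Submodule.span ℂ (Set.range (cupPowOne ℂ (ComplexPoints B.X) k)) := by
    rw [hspan]; exact Submodule.mem_top
  induction hy using Submodule.span_induction with
  | mem x hx =>
    obtain ⟨v, rfl⟩ := hx
    exact key v
  | zero => rw [map_zero, map_zero, smul_zero]
  | add x x' _ _ hx hx' => rw [map_add, map_add, hx, hx', smul_add]
  | smul r x _ hx => rw [map_smul, map_smul, hx, smul_comm]

/-- `0^* = 0` on `Hᵏ(B(ℂ); ℂ)` for `k ≥ 1` (here: `0 = 0 • 0` and `0ᵏ = 0`). A `private` copy, by a different proof, of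
`HodgeTheory.complexBetti_map_zero_hom_apply` of `WeilClassesSixfoldsProofs` (not imported: heavy cone). [cite: MumfordAV1970, §19] -/
private theorem complexBetti_map_zero_hom_apply' {k : ℕ} (hk : k ≠ 0) (y : complexBetti B.X k) :
    complexBetti.map (0 : A ⟶ B).hom.hom.hom k y = 0 := by
  have h := complexBetti_map_zsmul_hom_apply_eq_pow_smul (0 : ℤ) (0 : A ⟶ B) k y
  rwa [zero_smul, Int.cast_zero, zero_pow hk, zero_smul] at h

/-- `(-f)^* = (-1)ᵏ · f^*` on `Hᵏ`; in particular `(-f)^* = f^*` in even degrees. [cite: MumfordAV1970, §19] -/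
theorem complexBetti_map_neg_hom_apply (f : A ⟶ B) (k : ℕ) (y : complexBetti B.X k) :
    complexBetti.map (-f).hom.hom.hom k y = ((-1 : ℂ) ^ k) • complexBetti.map f.hom.hom.hom k y := by
  have h := complexBetti_map_zsmul_hom_apply_eq_pow_smul (-1 : ℤ) f k y
  rwa [neg_one_zsmul, Int.cast_neg, Int.cast_one] at h

end Literature.AlgebraicGeometry.HodgeTheory

/-! ## §1 The class `θ̂` on the dual `Â = A/K(Θ)` with `φ_Θ^*θ̂ = θ` -/

namespace Literature.AlgebraicGeometry.Motives

namespace AbelianVariety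

open Literature.AlgebraicGeometry.HodgeTheory

variable (A : AbelianVariety ℂ) {Θ : CartierDivisor A.X.left} (hΘ : Θ.IsAmple)

/-- **`θ̂ ∈ Hᵏ(Â(ℂ); ℂ)`, the class on the dual `Â = A/K(Θ)` with `φ_Θ^*θ̂ = θ`** (`φ_Θ` is an isogeny, so `φ_Θ^*` is
bijective on complex cohomology, `complexBetti_map_phiTheta_bijective`). For `Θ` principal, `θ̂ = (φ_Θ⁻¹)^*θ` is the class
corresponding to `θ` under `φ_Θ : A ⥲ Â` (`dualClassOf_eq_map_inv`); for `θ = [Θ]` principal this is the dual polarisation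
of `X̂ ≅ X` (Lange §2.1.1, §14.4 "the dual polarization"). [cite: Lange2023AbelianVarietiesComplex, §2.1.1 (p. 68) and §1.4.2]
[cite: vanGeemen1994HodgeAV, §3.6 (p. 236)] -/
def dualClassOf {k : ℕ} (θ : complexBetti A.X k) : complexBetti (A.dualOf Θ hΘ).X k :=
  Function.surjInv (A.complexBetti_map_phiTheta_bijective hΘ k).2 θ

variable {k : ℕ}

/-- **The defining equation `φ_Θ^*θ̂ = θ`.** [cite: vanGeemen1994HodgeAV, §3.6 (p. 236)] -/
theorem complexBetti_map_phiTheta_dualClassOf (θ : complexBetti A.X k) :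
    complexBetti.map (A.phiTheta Θ hΘ).hom.hom.hom k (A.dualClassOf hΘ θ) = θ :=
  Function.surjInv_eq (A.complexBetti_map_phiTheta_bijective hΘ k).2 θ

/-- Uniqueness: a class on `Â` pulling back to `θ` IS `θ̂`. [cite: vanGeemen1994HodgeAV, §3.6 (p. 236)] -/
theorem eq_dualClassOf_of_map_eq {θ : complexBetti A.X k} {θ' : complexBetti (A.dualOf Θ hΘ).X k}
    (h : complexBetti.map (A.phiTheta Θ hΘ).hom.hom.hom k θ' = θ) : θ' = A.dualClassOf hΘ θ :=
  (A.complexBetti_map_phiTheta_bijective hΘ k).1 (h.trans (A.complexBetti_map_phiTheta_dualClassOf hΘ θ).symm)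

/-- `θ ↦ θ̂` is additive. [cite: vanGeemen1994HodgeAV, §3.6 (p. 236)] -/
theorem dualClassOf_add (θ θ' : complexBetti A.X k) :
    A.dualClassOf hΘ (θ + θ') = A.dualClassOf hΘ θ + A.dualClassOf hΘ θ' :=
  (A.eq_dualClassOf_of_map_eq hΘ (by
    rw [map_add, A.complexBetti_map_phiTheta_dualClassOf, A.complexBetti_map_phiTheta_dualClassOf])).symm

/-- `θ ↦ θ̂` is `ℂ`-homogeneous. [cite: vanGeemen1994HodgeAV, §3.6 (p. 236)] -/
theorem dualClassOf_smul (c : ℂ) (θ : complexBetti A.X k) :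
    A.dualClassOf hΘ (c • θ) = c • A.dualClassOf hΘ θ :=
  (A.eq_dualClassOf_of_map_eq hΘ (by rw [map_smul, A.complexBetti_map_phiTheta_dualClassOf])).symm

/-- `0̂ = 0`. [cite: vanGeemen1994HodgeAV, §3.6 (p. 236)] -/
theorem dualClassOf_zero : A.dualClassOf hΘ (0 : complexBetti A.X k) = 0 :=
  (A.eq_dualClassOf_of_map_eq hΘ (by rw [map_zero])).symm

/-- `θ̂ = 0 ⟺ θ = 0`; in particular `θ ≠ 0 ⟹ θ̂ ≠ 0`. [cite: vanGeemen1994HodgeAV, §3.6 (p. 236)] -/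
theorem dualClassOf_ne_zero {θ : complexBetti A.X k} (hθ : θ ≠ 0) : A.dualClassOf hΘ θ ≠ 0 := by
  intro h
  apply hθ
  rw [← A.complexBetti_map_phiTheta_dualClassOf hΘ θ, h, map_zero]

/-- **Principal case: `θ̂ = (φ_Θ⁻¹)^*θ`** (`K(Θ) = 0`, so `φ_Θ : A ⥲ Â`, `isIso_phiTheta_of_KTheta_eq_bot`).
[cite: Lange2023AbelianVarietiesComplex, §2.3 (p. 101: φ_L is an isomorphism for L principal)] -/
theorem dualClassOf_eq_map_inv (hK : A.KTheta Θ = ⊥) (θ : complexBetti A.X k) :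
    haveI := A.isIso_phiTheta_of_KTheta_eq_bot hΘ hK
    A.dualClassOf hΘ θ = complexBetti.map (inv (A.phiTheta Θ hΘ)).hom.hom.hom k θ := by
  haveI := A.isIso_phiTheta_of_KTheta_eq_bot hΘ hK
  refine (A.eq_dualClassOf_of_map_eq hΘ ?_).symm
  rw [← complexBetti_map_comp_hom_apply, IsIso.hom_inv_id, complexBetti_map_id_hom_apply]

/-- **`θ̂` is a rational class of type `(p,p)` on `Â` whenever `θ` is one on `A`** (an isogeny induces a bijection of the
rational `(p,p)`-classes, van Geemen §3.6 — the tree's `bijOn_hodgeClasses_of_isIsogeny` for `φ_Θ`).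
[cite: vanGeemen1994HodgeAV, §3.6 (p. 236)] -/
theorem isRationalClass_isOfHodgeType_dualClassOf {p : ℕ} {θ : complexBetti A.X (2 * p)} (hθ : IsRationalClass θ)
    (hθ' : IsOfHodgeType A.dim A.X (2 * p) p p θ) :
    IsRationalClass (A.dualClassOf hΘ θ) ∧
      IsOfHodgeType (A.dualOf Θ hΘ).dim (A.dualOf Θ hΘ).X (2 * p) p p (A.dualClassOf hΘ θ) := by
  have hB := bijOn_hodgeClasses_of_isIsogeny (A.isIsogeny_phiTheta hΘ) p
  obtain ⟨δ, hδ, he⟩ := hB.surjOn (show θ ∈ {c | IsRationalClass c ∧ IsOfHodgeType A.dim A.X (2 * p) p p c} from ⟨hθ, hθ'⟩)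
  have hδeq : δ = A.dualClassOf hΘ θ := A.eq_dualClassOf_of_map_eq hΘ he
  exact hδeq ▸ hδ

/-- Conversely `θ` is rational of type `(p,p)` as soon as `θ̂` is (pull back along `φ_Θ`). [cite: vanGeemen1994HodgeAV, §3.6 (p. 236)] -/
theorem isRationalClass_isOfHodgeType_of_dualClassOf {p : ℕ} {θ : complexBetti A.X (2 * p)}
    (h : IsRationalClass (A.dualClassOf hΘ θ) ∧
      IsOfHodgeType (A.dualOf Θ hΘ).dim (A.dualOf Θ hΘ).X (2 * p) p p (A.dualClassOf hΘ θ)) :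
    IsRationalClass θ ∧ IsOfHodgeType A.dim A.X (2 * p) p p θ := by
  have h' := AbelianVariety.mapsTo_hodgeClasses (A.phiTheta Θ hΘ) p h
  rwa [Set.mem_setOf_eq, A.complexBetti_map_phiTheta_dualClassOf hΘ θ] at h'

end AbelianVariety

end Literature.AlgebraicGeometry.Motives

/-! ## §2 Markman's Weil polarisation class `Ξ = p₁^*θ + d·p₂^*θ̂` on `A × Â` and `φ_d^*Ξ = d·Ξ` -/

namespace Literature.AlgebraicGeometry.Markman2025

open Literature.AlgebraicGeometry.Motives Literature.AlgebraicGeometry.Motives.AbelianVariety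
open Literature.AlgebraicGeometry.HodgeTheory
open Literature.AlgebraicTopology.SingularHomology

variable (A : AbelianVariety ℂ) {Θ : CartierDivisor A.X.left} (hΘ : Θ.IsAmple)

/-- **Markman's Weil polarisation class `Ξ = p₁^*θ + d·p₂^*θ̂ ∈ H²((A × Â)(ℂ); ℂ)`** attached to a degree-`2` class `θ`
on `A` (in the rôle of `[Θ]`) and the level `d`: the closed form, on the real carrier, of "`Ξ_P(x, y) := (f(x), y)_V`"
(§3.2) for `f = η(√-d) = φ_d : (x, y) ↦ (-d φ_Θ⁻¹y, φ_Θ x)` (module docstring: the computation), the class `h` of the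
polarised abelian variety of Weil type `(X × X̂, η, h)` of §1.3 / Cor. 3.2.3. A SPLIT class: pull-backs of `θ` and of
`d·θ̂` from the two factors. [cite: Markman2025SecantWeil, §3.2 (p. 15: Ξ_P(x,y) := (f(x),y)_V) and Cor. 3.2.3] -/
def weilPolarizationClass (d : ℕ) (θ : complexBetti A.X 2) : complexBetti (A.prod (A.dualOf Θ hΘ)).X 2 :=
  complexBetti.map (fst A (A.dualOf Θ hΘ)).hom.hom.hom 2 θ +
    (d : ℂ) • complexBetti.map (snd A (A.dualOf Θ hΘ)).hom.hom.hom 2 (A.dualClassOf hΘ θ)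


/-- Unfolding lemma: `Ξ = p₁^*θ + d·p₂^*θ̂`. [cite: Markman2025SecantWeil, §3.2 (p. 15)] -/
theorem weilPolarizationClass_eq (d : ℕ) (θ : complexBetti A.X 2) :
    weilPolarizationClass A hΘ d θ = complexBetti.map (fst A (A.dualOf Θ hΘ)).hom.hom.hom 2 θ +
      (d : ℂ) • complexBetti.map (snd A (A.dualOf Θ hΘ)).hom.hom.hom 2 (A.dualClassOf hΘ θ) :=
  rfl

/-- `Ξ` is additive in `θ`. [cite: Markman2025SecantWeil, §3.2 (p. 15)] -/
theorem weilPolarizationClass_add (d : ℕ) (θ θ' : complexBetti A.X 2) :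
    weilPolarizationClass A hΘ d (θ + θ') = weilPolarizationClass A hΘ d θ + weilPolarizationClass A hΘ d θ' := by
  simp only [weilPolarizationClass, dualClassOf_add, map_add, smul_add]
  abel

/-- `Ξ` is `ℂ`-homogeneous in `θ`. [cite: Markman2025SecantWeil, §3.2 (p. 15)] -/
theorem weilPolarizationClass_smul (d : ℕ) (c : ℂ) (θ : complexBetti A.X 2) :
    weilPolarizationClass A hΘ d (c • θ) = c • weilPolarizationClass A hΘ d θ := by
  simp only [weilPolarizationClass, dualClassOf_smul, map_smul, smul_add, smul_comm (d : ℂ) c]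

/-- **Restriction to `A × {0}` recovers `θ`: `(1, 0)^*Ξ = θ`** (`(1,0) ≫ p₁ = 1`, `(1,0) ≫ p₂ = 0` and `0^* = 0` on `H²`).
[cite: Markman2025SecantWeil, §3.2 (p. 15: Ξ_P is non-degenerate)] -/
theorem complexBetti_map_prodLift_id_zero_weilPolarizationClass (d : ℕ) (θ : complexBetti A.X 2) :
    complexBetti.map (prodLift (𝟙 A) (0 : A ⟶ A.dualOf Θ hΘ)).hom.hom.hom 2 (weilPolarizationClass A hΘ d θ) = θ := by
  rw [weilPolarizationClass, map_add, map_smul, ← complexBetti_map_comp_hom_apply, prodLift_fst,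
    complexBetti_map_id_hom_apply, ← complexBetti_map_comp_hom_apply, prodLift_snd,
    complexBetti_map_zero_hom_apply' two_ne_zero, smul_zero, add_zero]

/-- **`θ ≠ 0 ⟹ Ξ ≠ 0`** ("The 2-form `Ξ_P` is non-degenerate" — here only non-vanishing, by restriction to `A × {0}`).
[cite: Markman2025SecantWeil, §3.2 (p. 15)] -/
theorem weilPolarizationClass_ne_zero (d : ℕ) {θ : complexBetti A.X 2} (hθ : θ ≠ 0) : weilPolarizationClass A hΘ d θ ≠ 0 := by
  intro h
  apply hθ
  rw [← complexBetti_map_prodLift_id_zero_weilPolarizationClass A hΘ d θ, h, map_zero]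

/-- **`Ξ` is a rational class of Hodge type `(1,1)` whenever `θ` is** ("the rational `(1,1)` class `Ξ_P`", Cor. 3.2.3):
pull-backs along homomorphisms, `θ ↦ θ̂`, sums and rational multiples preserve rationality and Hodge type.
[cite: Markman2025SecantWeil, §3.2 Cor. 3.2.3] [cite: vanGeemen1994HodgeAV, §3.6 (p. 236)] -/
theorem isRationalClass_isOfHodgeType_weilPolarizationClass (d : ℕ) {θ : complexBetti A.X 2} (hθ : IsRationalClass θ)
    (hθ' : IsOfHodgeType A.dim A.X 2 1 1 θ) :
    IsRationalClass (weilPolarizationClass A hΘ d θ) ∧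
      IsOfHodgeType (A.prod (A.dualOf Θ hΘ)).dim (A.prod (A.dualOf Θ hΘ)).X 2 1 1 (weilPolarizationClass A hΘ d θ) := by
  have hP : IsSmoothProjective (A.prod (A.dualOf Θ hΘ)).dim (A.prod (A.dualOf Θ hΘ)).X := isSmoothProjective_holds
  have h₁ := AbelianVariety.mapsTo_hodgeClasses (fst A (A.dualOf Θ hΘ)) 1 ⟨hθ, hθ'⟩
  have h₂ := AbelianVariety.mapsTo_hodgeClasses (snd A (A.dualOf Θ hΘ)) 1
    (A.isRationalClass_isOfHodgeType_dualClassOf hΘ hθ hθ')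
  refine ⟨?_, h₁.2.add hP (h₂.2.smul _)⟩
  have e : weilPolarizationClass A hΘ d θ = complexBetti.map (fst A (A.dualOf Θ hΘ)).hom.hom.hom 2 θ +
      ((d : ℚ) : ℂ) • complexBetti.map (snd A (A.dualOf Θ hΘ)).hom.hom.hom 2 (A.dualClassOf hΘ θ) := by
    rw [weilPolarizationClass, Rat.cast_natCast]
  rw [e]
  exact h₁.1.add (h₂.1.smul _)

/-- **`Ξ` is ALGEBRAIC (`∈ N¹H² = algebraicClasses (A × Â) 1`) whenever `θ` is rational of type `(1,1)`** — Lefschetz's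
theorem on `(1,1)`-classes, proved in the tree (`lefschetzOneOne_rational_holds`). [cite: VoisinHodgeI2002, Thm. 11.33 and §7.1] -/
theorem weilPolarizationClass_mem_algebraicClasses (d : ℕ) {θ : complexBetti A.X 2} (hθ : IsRationalClass θ)
    (hθ' : IsOfHodgeType A.dim A.X 2 1 1 θ) :
    weilPolarizationClass A hΘ d θ ∈ algebraicClasses (A.prod (A.dualOf Θ hΘ)).X 1 := by
  have h := isRationalClass_isOfHodgeType_weilPolarizationClass A hΘ d hθ hθ'
  exact lefschetzOneOne_rational_holds isSmoothProjective_holds _ h.1 h.2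

variable {A}

/-- **Cor. 3.2.3: `φ_d^*Ξ = d·Ξ`** — "`f^*Ξ_P(x, y) := Ξ_P(f(x), f(y)) = […] = dΞ_P(x, y)`, verifying the condition on the
polarization in [van-Geemen]" (`E(kx, ky) = Nm(k)E(x, y)` with `k = √-d`, `Nm(k) = d`), for `Θ` PRINCIPAL (so that
`φ_d = weilOperator hΘ hK d : (x, y) ↦ (-d φ_Θ⁻¹ y, φ_Θ x)` is defined). On the real carrier: `φ_d^*p₁^*θ =
(-d·(p₂ ≫ φ_Θ⁻¹))^*θ = d²·p₂^*θ̂` (`[m]^* = m²` on `H²`) and `φ_d^*(d·p₂^*θ̂) = d·(p₁ ≫ φ_Θ)^*θ̂ = d·p₁^*θ`.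
[cite: Markman2025SecantWeil, §3.2 Cor. 3.2.3 (proof: f^*Ξ_P = dΞ_P)] [cite: vanGeemen1994HodgeAV, 5.2] -/
theorem complexBetti_map_weilOperator_weilPolarizationClass (hK : A.KTheta Θ = ⊥) (d : ℕ) (θ : complexBetti A.X 2) :
    complexBetti.map (weilOperator hΘ hK d).hom.hom.hom 2 (weilPolarizationClass A hΘ d θ) =
      (d : ℂ) • weilPolarizationClass A hΘ d θ := by
  haveI := A.isIso_phiTheta_of_KTheta_eq_bot hΘ hK
  -- the two components of `φ_d`
  have h1 : complexBetti.map (weilOperator hΘ hK d).hom.hom.hom 2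
      (complexBetti.map (fst A (A.dualOf Θ hΘ)).hom.hom.hom 2 θ) =
        ((d : ℂ) ^ 2) • complexBetti.map (snd A (A.dualOf Θ hΘ)).hom.hom.hom 2 (A.dualClassOf hΘ θ) := by
    rw [← complexBetti_map_comp_hom_apply, weilOperator_fst, complexBetti_map_neg_hom_apply,
      show (snd A (A.dualOf Θ hΘ) ≫ inv (A.phiTheta Θ hΘ)) = snd A (A.dualOf Θ hΘ) ≫ inv (A.phiTheta Θ hΘ) from rfl,
      show ((d : ℤ) • (snd A (A.dualOf Θ hΘ) ≫ inv (A.phiTheta Θ hΘ))) =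
        (d : ℤ) • (snd A (A.dualOf Θ hΘ) ≫ inv (A.phiTheta Θ hΘ)) from rfl,
      complexBetti_map_zsmul_hom_apply_eq_pow_smul, complexBetti_map_comp_hom_apply,
      ← A.dualClassOf_eq_map_inv hΘ hK θ, Int.cast_natCast]
    norm_num
  have h2 : complexBetti.map (weilOperator hΘ hK d).hom.hom.hom 2
      (complexBetti.map (snd A (A.dualOf Θ hΘ)).hom.hom.hom 2 (A.dualClassOf hΘ θ)) =
        complexBetti.map (fst A (A.dualOf Θ hΘ)).hom.hom.hom 2 θ := by
    rw [← complexBetti_map_comp_hom_apply, weilOperator_snd, complexBetti_map_comp_hom_apply,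
      A.complexBetti_map_phiTheta_dualClassOf hΘ θ]
  rw [weilPolarizationClass, map_add, map_smul, h1, h2, smul_add, smul_smul, add_comm]
  congr 1
  rw [pow_two]

/-! ## §3 The descended polarisation `h_Y` on `Y = (A × Â)/Ḡ` and the descended operator `ψ_Y` -/

variable (A) (G₁ G₂ : Subgroup (A.Points ℂ)) {n : ℕ} (hn : n ≠ 0) (h₁ : G₁ ≤ A.torsionPoints ℂ n)
  (h₂ : G₂ ≤ A.torsionPoints ℂ n)

/-- **The descended polarisation class `h_Y ∈ H²(Y(ℂ); ℂ)` on `Y = (A × Â)/Ḡ`: the unique class with `q^*h_Y = Ξ(θ)`**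
(`q^*` is bijective on complex cohomology — "the arrows labeled `q^*` are all isomorphisms", proof of Lemma 9.3.11; the
tree's `complexBetti_map_secantQuotientMap_bijective`), i.e. `h_Y = (q^*)⁻¹(p₁^*θ + d·p₂^*θ̂)`: the polarisation of the
anchor `(Y_d, h)` on the real carrier (the translations `Ḡ` act trivially on cohomology, so `Ξ` descends rationally).
[cite: Markman2025SecantWeil, §1.5 (p. 7: q induces a local isomorphism of Kuranishi spaces) and §9.3 (proof of Lemma 9.3.11)]
[cite: vanGeemen1994HodgeAV, §3.6 (p. 236)] -/
def secantPolarizationClass (d : ℕ) (θ : complexBetti A.X 2) : complexBetti (secantQuotient A hΘ G₁ G₂ hn h₁ h₂).X 2 :=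
  Function.surjInv (complexBetti_map_secantQuotientMap_bijective A hΘ G₁ G₂ hn h₁ h₂ 2).2 (weilPolarizationClass A hΘ d θ)

/-- **The defining equation `q^*h_Y = Ξ = p₁^*θ + d·p₂^*θ̂`.** [cite: Markman2025SecantWeil, §9.3 (proof of Lemma 9.3.11: q^* is an isomorphism)] -/
theorem complexBetti_map_secantQuotientMap_secantPolarizationClass (d : ℕ) (θ : complexBetti A.X 2) :
    complexBetti.map (secantQuotientMap A hΘ G₁ G₂ hn h₁ h₂).hom.hom.hom 2
        (secantPolarizationClass A hΘ G₁ G₂ hn h₁ h₂ d θ) = weilPolarizationClass A hΘ d θ :=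
  Function.surjInv_eq (complexBetti_map_secantQuotientMap_bijective A hΘ G₁ G₂ hn h₁ h₂ 2).2 _

/-- Uniqueness: a class on `Y` with `q^*h = Ξ(θ)` IS `h_Y(θ)`. [cite: Markman2025SecantWeil, §9.3 (proof of Lemma 9.3.11)] -/
theorem eq_secantPolarizationClass_of_map_eq (d : ℕ) {θ : complexBetti A.X 2}
    {h : complexBetti (secantQuotient A hΘ G₁ G₂ hn h₁ h₂).X 2}
    (hh : complexBetti.map (secantQuotientMap A hΘ G₁ G₂ hn h₁ h₂).hom.hom.hom 2 h = weilPolarizationClass A hΘ d θ) :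
    h = secantPolarizationClass A hΘ G₁ G₂ hn h₁ h₂ d θ :=
  (complexBetti_map_secantQuotientMap_bijective A hΘ G₁ G₂ hn h₁ h₂ 2).1
    (hh.trans (complexBetti_map_secantQuotientMap_secantPolarizationClass A hΘ G₁ G₂ hn h₁ h₂ d θ).symm)

/-- `h_Y` is additive in `θ`. [cite: Markman2025SecantWeil, §9.3 (proof of Lemma 9.3.11)] -/
theorem secantPolarizationClass_add (d : ℕ) (θ θ' : complexBetti A.X 2) :
    secantPolarizationClass A hΘ G₁ G₂ hn h₁ h₂ d (θ + θ') =
      secantPolarizationClass A hΘ G₁ G₂ hn h₁ h₂ d θ + secantPolarizationClass A hΘ G₁ G₂ hn h₁ h₂ d θ' :=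
  (eq_secantPolarizationClass_of_map_eq A hΘ G₁ G₂ hn h₁ h₂ d (by
    rw [map_add, complexBetti_map_secantQuotientMap_secantPolarizationClass,
      complexBetti_map_secantQuotientMap_secantPolarizationClass, weilPolarizationClass_add])).symm

/-- `h_Y` is `ℂ`-homogeneous in `θ`. [cite: Markman2025SecantWeil, §9.3 (proof of Lemma 9.3.11)] -/
theorem secantPolarizationClass_smul (d : ℕ) (c : ℂ) (θ : complexBetti A.X 2) :
    secantPolarizationClass A hΘ G₁ G₂ hn h₁ h₂ d (c • θ) = c • secantPolarizationClass A hΘ G₁ G₂ hn h₁ h₂ d θ :=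
  (eq_secantPolarizationClass_of_map_eq A hΘ G₁ G₂ hn h₁ h₂ d (by
    rw [map_smul, complexBetti_map_secantQuotientMap_secantPolarizationClass, weilPolarizationClass_smul])).symm

/-- **`θ ≠ 0 ⟹ h_Y ≠ 0`.** [cite: Markman2025SecantWeil, §3.2 (p. 15: Ξ_P is non-degenerate)] -/
theorem secantPolarizationClass_ne_zero (d : ℕ) {θ : complexBetti A.X 2} (hθ : θ ≠ 0) :
    secantPolarizationClass A hΘ G₁ G₂ hn h₁ h₂ d θ ≠ 0 := by
  intro h
  apply weilPolarizationClass_ne_zero A hΘ d hθ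
  rw [← complexBetti_map_secantQuotientMap_secantPolarizationClass A hΘ G₁ G₂ hn h₁ h₂ d θ, h, map_zero]

/-- **`h_Y` is a rational class of type `(1,1)` on `Y` whenever `θ` is one on `A`** (`q` is an isogeny: a bijection of the
rational `(1,1)`-classes, `bijOn_hodgeClasses_secantQuotientMap`, applied to `Ξ(θ)`).
[cite: vanGeemen1994HodgeAV, §3.6 (p. 236)] [cite: Markman2025SecantWeil, §3.2 Cor. 3.2.3] -/
theorem isRationalClass_isOfHodgeType_secantPolarizationClass (d : ℕ) {θ : complexBetti A.X 2} (hθ : IsRationalClass θ)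
    (hθ' : IsOfHodgeType A.dim A.X 2 1 1 θ) :
    IsRationalClass (secantPolarizationClass A hΘ G₁ G₂ hn h₁ h₂ d θ) ∧
      IsOfHodgeType (secantQuotient A hΘ G₁ G₂ hn h₁ h₂).dim (secantQuotient A hΘ G₁ G₂ hn h₁ h₂).X 2 1 1
        (secantPolarizationClass A hΘ G₁ G₂ hn h₁ h₂ d θ) := by
  have hB := bijOn_hodgeClasses_secantQuotientMap A hΘ G₁ G₂ hn h₁ h₂ 1
  obtain ⟨δ, hδ, he⟩ := hB.surjOn (isRationalClass_isOfHodgeType_weilPolarizationClass A hΘ d hθ hθ')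
  have hδeq : δ = secantPolarizationClass A hΘ G₁ G₂ hn h₁ h₂ d θ :=
    eq_secantPolarizationClass_of_map_eq A hΘ G₁ G₂ hn h₁ h₂ d he
  exact hδeq ▸ hδ

/-- **`h_Y` is ALGEBRAIC (`∈ N¹H²(Y(ℂ); ℂ)`) whenever `θ` is rational of type `(1,1)`** (Lefschetz `(1,1)` in the tree).
[cite: VoisinHodgeI2002, Thm. 11.33 and §7.1] -/
theorem secantPolarizationClass_mem_algebraicClasses (d : ℕ) {θ : complexBetti A.X 2} (hθ : IsRationalClass θ)
    (hθ' : IsOfHodgeType A.dim A.X 2 1 1 θ) :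
    secantPolarizationClass A hΘ G₁ G₂ hn h₁ h₂ d θ ∈ algebraicClasses (secantQuotient A hΘ G₁ G₂ hn h₁ h₂).X 1 := by
  have h := isRationalClass_isOfHodgeType_secantPolarizationClass A hΘ G₁ G₂ hn h₁ h₂ d hθ hθ'
  exact lefschetzOneOne_rational_holds isSmoothProjective_holds _ h.1 h.2

/-- **`dim Y = dim A + dim A`**, the carrier file's `dim_secantQuotient` with its `dim (A × Â) = dim A + dim Â` binder fed
by the tree's (proved) `AbelianVariety.dim_prod`. [cite: Markman2025SecantWeil, §1.5 (p. 7: Y an abelian sixfold for dim X = 3)] -/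
theorem dim_secantQuotient' : (secantQuotient A hΘ G₁ G₂ hn h₁ h₂).dim = A.dim + A.dim :=
  dim_secantQuotient A hΘ G₁ G₂ hn h₁ h₂ (AbelianVariety.dim_prod A (A.dualOf Θ hΘ))

variable {A hΘ G₁ G₂ hn h₁ h₂} {d : ℕ}

/-- `r ≫ q = n • 𝟙_Y` for a quasi-inverse `r` of the isogeny `q` (`q ≫ r = n • 𝟙`; `q` is an epimorphism among
homomorphisms). [cite: MumfordAV1970, §19 (Remark p. 169: quasi-inverse of an isogeny)] -/
theorem comp_secantQuotientMap_eq_zsmul_id_of_comp_eq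
    {r : secantQuotient A hΘ G₁ G₂ hn h₁ h₂ ⟶ A.prod (A.dualOf Θ hΘ)}
    (hr : secantQuotientMap A hΘ G₁ G₂ hn h₁ h₂ ≫ r = (n : ℤ) • 𝟙 (A.prod (A.dualOf Θ hΘ))) :
    r ≫ secantQuotientMap A hΘ G₁ G₂ hn h₁ h₂ = (n : ℤ) • 𝟙 (secantQuotient A hΘ G₁ G₂ hn h₁ h₂) := by
  apply (isIsogeny_secantQuotientMap A hΘ G₁ G₂ hn h₁ h₂).cancel_left
  rw [← Category.assoc, hr, Preadditive.zsmul_comp, Category.id_comp, Preadditive.comp_zsmul, Category.comp_id]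

/-- **The pull-back of `h_Y` along a quasi-inverse: `r^*Ξ(θ) = n²·h_Y(θ)`** (`r^*q^*h_Y = (r ≫ q)^*h_Y = [n]^*h_Y`).
[cite: MumfordAV1970, §19] -/
theorem complexBetti_map_weilPolarizationClass_of_comp_eq (d : ℕ)
    {r : secantQuotient A hΘ G₁ G₂ hn h₁ h₂ ⟶ A.prod (A.dualOf Θ hΘ)}
    (hr : secantQuotientMap A hΘ G₁ G₂ hn h₁ h₂ ≫ r = (n : ℤ) • 𝟙 (A.prod (A.dualOf Θ hΘ))) (θ : complexBetti A.X 2) :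
    complexBetti.map r.hom.hom.hom 2 (weilPolarizationClass A hΘ d θ) =
      ((n : ℂ) ^ 2) • secantPolarizationClass A hΘ G₁ G₂ hn h₁ h₂ d θ := by
  rw [← complexBetti_map_secantQuotientMap_secantPolarizationClass A hΘ G₁ G₂ hn h₁ h₂ d θ,
    ← complexBetti_map_comp_hom_apply, comp_secantQuotientMap_eq_zsmul_id_of_comp_eq hr,
    complexBetti_map_zsmul_hom_apply_eq_pow_smul, complexBetti_map_id_hom_apply, Int.cast_natCast]

/-- **The descended operator `ψ_Y := r ≫ φ_d ≫ q` on `Y` squares to `-(n²d)`** (the carrier file's `comp_self_of_descent`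
with `φ_d ≫ φ_d = -d`: a `ℚ(√-d) = ℚ(√-n²d)`-structure on `Y`, "the `K`-action carried to `Y` through `q`").
[cite: Markman2025SecantWeil, §1.5 (p. 7) and §3.2] [cite: MumfordAV1970, §19] -/
theorem descendedWeilOperator_comp_self (hK : A.KTheta Θ = ⊥) (d : ℕ)
    {r : secantQuotient A hΘ G₁ G₂ hn h₁ h₂ ⟶ A.prod (A.dualOf Θ hΘ)}
    (hr : secantQuotientMap A hΘ G₁ G₂ hn h₁ h₂ ≫ r = (n : ℤ) • 𝟙 (A.prod (A.dualOf Θ hΘ))) :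
    (r ≫ weilOperator hΘ hK d ≫ secantQuotientMap A hΘ G₁ G₂ hn h₁ h₂) ≫
        (r ≫ weilOperator hΘ hK d ≫ secantQuotientMap A hΘ G₁ G₂ hn h₁ h₂) =
      ((n : ℤ) * n * (-(d : ℤ))) • 𝟙 (secantQuotient A hΘ G₁ G₂ hn h₁ h₂) :=
  comp_self_of_descent (isIsogeny_secantQuotientMap A hΘ G₁ G₂ hn h₁ h₂) hr
    (by rw [weilOperator_comp_self, neg_smul])

/-- **The Weil-type condition ON `Y`: `ψ_Y^*h_Y = (n²d)·h_Y`** for `ψ_Y = r ≫ φ_d ≫ q` (`ψ_Y^*h_Y = r^*φ_d^*q^*h_Y =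
r^*φ_d^*Ξ = d·r^*Ξ = d n²·h_Y`; with `ψ_Y² = -n²d` this is van Geemen's `E(kx, ky) = Nm(k)E(x, y)` for `k = √-n²d`).
[cite: Markman2025SecantWeil, §3.2 Cor. 3.2.3] [cite: vanGeemen1994HodgeAV, 5.2] -/
theorem complexBetti_map_descendedWeilOperator_secantPolarizationClass (hK : A.KTheta Θ = ⊥) (d : ℕ)
    {r : secantQuotient A hΘ G₁ G₂ hn h₁ h₂ ⟶ A.prod (A.dualOf Θ hΘ)}
    (hr : secantQuotientMap A hΘ G₁ G₂ hn h₁ h₂ ≫ r = (n : ℤ) • 𝟙 (A.prod (A.dualOf Θ hΘ))) (θ : complexBetti A.X 2) :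
    complexBetti.map (r ≫ weilOperator hΘ hK d ≫ secantQuotientMap A hΘ G₁ G₂ hn h₁ h₂).hom.hom.hom 2
        (secantPolarizationClass A hΘ G₁ G₂ hn h₁ h₂ d θ) =
      ((n : ℂ) ^ 2 * d) • secantPolarizationClass A hΘ G₁ G₂ hn h₁ h₂ d θ := by
  rw [complexBetti_map_comp_hom_apply, complexBetti_map_comp_hom_apply,
    complexBetti_map_secantQuotientMap_secantPolarizationClass, complexBetti_map_weilOperator_weilPolarizationClass,
    map_smul, complexBetti_map_weilPolarizationClass_of_comp_eq d hr, smul_smul, mul_comm]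

/-! ## §4 The anchor envelope WITH ITS CLASS, at scheme level: `X ≅ (J × Ĵ)/Ḡ` and `θ_X = e^*h_Y(θ)`, `θ ∈ ℚˣ·[Θ]` -/

/-- **`(X, θ_X)` is a secant-quotient anchor of level `d` WITH ITS DESCENDED POLARISATION CLASS** (the SHAPE of Markman's
anchor `(Y_d, h)`, on a complex scheme `X` with a degree-`2` class `θ_X` — the signature `𝔄 X θ` of the ring-2 anchor
predicates): there are a smooth projective complex curve `C`, a Jacobian `𝒥` of `C` of dimension `3`, a Riemann theta
divisor `Θ` of `𝒥` which is a principal polarisation divisor, a polarisation class `θ` OF `Θ` (`θ ∈ ℚˣ·[Θ]`: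
`AbelianVariety.IsPolarizationClassOf`, `Motives/AbelianVarietyPrincipalPolarization`), cyclic subgroups `G₁, G₂ ≤ J[d+1](ℂ)`
of order `d+1` with `G₁ ⊓ G₂ = ⊥`, and an isomorphism of `ℂ`-schemes `e : X ≅ (J × Ĵ)/Ḡ` (a CHART) with
**`θ_X = e^*h_Y(θ)`**, `h_Y(θ)` the descent of `Ξ(θ) = p₁^*θ + d·p₂^*θ̂`. ENVELOPE exactly as `IsSecantQuotientSixfold`
(carrier file): "generic non-hyperelliptic `C`", the general position of Lemma 9.3.1 (`TranslatesInGeneralPosition`) and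
"`d` even" are NOT part of it — conjoin as needed; nor is the hard Lefschetz property of `θ_X` (module docstring).
[cite: Markman2025SecantWeil, §1.3 (p. 5: (X × X̂, η, h)), §1.5 (p. 7) and §3.2 Cor. 3.2.3] -/
def IsSecantQuotientAnchorWith (d : ℕ) (X : SchemeOver ℂ) (θX : complexBetti X 2) : Prop :=
  ∃ (C : SchemeOver ℂ) (_ : IsSmoothProjective 1 C) (𝒥 : Jacobian C) (_ : 𝒥.J.dim = 3)
    (Θ : CartierDivisor 𝒥.J.X.left) (_ : 𝒥.IsRiemannThetaDivisor Θ) (hP : 𝒥.J.IsPrincipalPolarizationDivisor Θ)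
    (θ : complexBetti 𝒥.J.X 2) (_ : 𝒥.J.IsPolarizationClassOf Θ θ)
    (G₁ G₂ : Subgroup (𝒥.J.Points ℂ)) (h₁ : G₁ ≤ 𝒥.J.torsionPoints ℂ (d + 1 : ℕ))
    (h₂ : G₂ ≤ 𝒥.J.torsionPoints ℂ (d + 1 : ℕ)),
    IsCyclic G₁ ∧ Nat.card G₁ = d + 1 ∧ IsCyclic G₂ ∧ Nat.card G₂ = d + 1 ∧ G₁ ⊓ G₂ = ⊥ ∧
    ∃ e : X ≅ (secantQuotient 𝒥.J hP.isAmple G₁ G₂ (Nat.succ_ne_zero d) h₁ h₂).X,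
      θX = complexBetti.map e.hom 2 (secantPolarizationClass 𝒥.J hP.isAmple G₁ G₂ (Nat.succ_ne_zero d) h₁ h₂ d θ)

variable {X : SchemeOver ℂ} {θX : complexBetti X 2}

/-- **Introduction rule**: the chart `e : X ≅ (J × Ĵ)/Ḡ` and a polarisation class `θ` of `Θ` exhibit `(X, e^*h_Y(θ))` as a
secant-quotient anchor with its class. [cite: Markman2025SecantWeil, §1.5 (p. 7)] -/
theorem isSecantQuotientAnchorWith_map {C : SchemeOver ℂ} (hC : IsSmoothProjective 1 C) (𝒥 : Jacobian C)
    (h3 : 𝒥.J.dim = 3) {Θ : CartierDivisor 𝒥.J.X.left} (hR : 𝒥.IsRiemannThetaDivisor Θ)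
    (hP : 𝒥.J.IsPrincipalPolarizationDivisor Θ) {θ : complexBetti 𝒥.J.X 2} (hθ : 𝒥.J.IsPolarizationClassOf Θ θ)
    {G₁ G₂ : Subgroup (𝒥.J.Points ℂ)} (h₁ : G₁ ≤ 𝒥.J.torsionPoints ℂ (d + 1 : ℕ))
    (h₂ : G₂ ≤ 𝒥.J.torsionPoints ℂ (d + 1 : ℕ)) (hc₁ : IsCyclic G₁) (hn₁ : Nat.card G₁ = d + 1) (hc₂ : IsCyclic G₂)
    (hn₂ : Nat.card G₂ = d + 1) (hbot : G₁ ⊓ G₂ = ⊥)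
    (e : X ≅ (secantQuotient 𝒥.J hP.isAmple G₁ G₂ (Nat.succ_ne_zero d) h₁ h₂).X) :
    IsSecantQuotientAnchorWith d X (complexBetti.map e.hom 2
      (secantPolarizationClass 𝒥.J hP.isAmple G₁ G₂ (Nat.succ_ne_zero d) h₁ h₂ d θ)) :=
  ⟨C, hC, 𝒥, h3, Θ, hR, hP, θ, hθ, G₁, G₂, h₁, h₂, hc₁, hn₁, hc₂, hn₂, hbot, e, rfl⟩

/-- Forgetting the class (for an abelian variety `Y`): `IsSecantQuotientAnchorWith d Y.X θ ⟹ IsSecantQuotientSixfold d Y`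
— an isomorphism of the underlying `ℂ`-schemes of two abelian varieties yields an isomorphism of abelian varieties (Milne
1986 Rem. 2.3, the tree's `AbelianVariety.isoOfOverIso'`). [cite: Milne1986AbelianVarieties, §2 Remark 2.3]
[cite: Markman2025SecantWeil, §1.5 (p. 7)] -/
theorem IsSecantQuotientAnchorWith.isSecantQuotientSixfold {Y : AbelianVariety ℂ} {θY : complexBetti Y.X 2}
    (h : IsSecantQuotientAnchorWith d Y.X θY) : IsSecantQuotientSixfold d Y := by
  obtain ⟨C, hC, 𝒥, h3, Θ, hR, hP, θ, -, G₁, G₂, h₁, h₂, hc₁, hn₁, hc₂, hn₂, hbot, e, -⟩ := h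
  exact ⟨C, hC, 𝒥, h3, Θ, hR, hP, G₁, G₂, h₁, h₂, hc₁, hn₁, hc₂, hn₂, hbot, ⟨AbelianVariety.isoOfOverIso' e⟩⟩

/-- **A secant-quotient anchor is a smooth projective `6`-fold** (`(J × Ĵ)/Ḡ` is an abelian variety of dimension
`2·dim J = 6`, and smooth projectivity transports along the chart `e`). [cite: Markman2025SecantWeil, §1.5 (p. 7: an abelian sixfold)] -/
theorem IsSecantQuotientAnchorWith.isSmoothProjective (h : IsSecantQuotientAnchorWith d X θX) : IsSmoothProjective 6 X := by
  obtain ⟨C, -, 𝒥, h3, Θ, -, hP, θ, -, G₁, G₂, h₁, h₂, -, -, -, -, -, e, -⟩ := h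
  have h6 : (secantQuotient 𝒥.J hP.isAmple G₁ G₂ (Nat.succ_ne_zero d) h₁ h₂).dim = 6 := by
    rw [dim_secantQuotient', h3]
  have hsQ : IsSmoothProjective (secantQuotient 𝒥.J hP.isAmple G₁ G₂ (Nat.succ_ne_zero d) h₁ h₂).dim
      (secantQuotient 𝒥.J hP.isAmple G₁ G₂ (Nat.succ_ne_zero d) h₁ h₂).X := isSmoothProjective_holds
  rw [h6] at hsQ
  exact hsQ.of_iso e.symm

/-- **The class `θ_X` of a secant-quotient anchor is rational, non-zero, of Hodge type `(1,1)` in dimension `6` and algebraic**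
(from `θ ∈ ℚˣ·[Θ]`: rational, non-zero, `(1,1)`; carried by `h_Y(·)`, `dim (J × Ĵ)/Ḡ = 6`, transported along the chart `e`
— `isRationalClass_map_iff_of_iso`, `isOfHodgeType_map_iff_of_iso` —, and algebraic by Lefschetz `(1,1)` on the smooth
projective `X`). [cite: Markman2025SecantWeil, §3.2 Cor. 3.2.3 (the rational (1,1) class Ξ_P)] [cite: VoisinHodgeI2002, Thm. 11.33] -/
theorem IsSecantQuotientAnchorWith.isRationalClass_and (h : IsSecantQuotientAnchorWith d X θX) :
    IsRationalClass θX ∧ θX ≠ 0 ∧ IsOfHodgeType 6 X 2 1 1 θX ∧ θX ∈ algebraicClasses X 1 := by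
  have hX6 := h.isSmoothProjective
  obtain ⟨C, -, 𝒥, h3, Θ, -, hP, θ, hθ, G₁, G₂, h₁, h₂, -, -, -, -, -, e, hθX⟩ := h
  have hq := isRationalClass_isOfHodgeType_secantPolarizationClass 𝒥.J hP.isAmple G₁ G₂ (Nat.succ_ne_zero d) h₁ h₂ d
    hθ.isRationalClass hθ.isOfHodgeType
  have h6 : (secantQuotient 𝒥.J hP.isAmple G₁ G₂ (Nat.succ_ne_zero d) h₁ h₂).dim = 6 := by
    rw [dim_secantQuotient', h3]
  have hq6 : IsOfHodgeType 6 (secantQuotient 𝒥.J hP.isAmple G₁ G₂ (Nat.succ_ne_zero d) h₁ h₂).X 2 1 1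
      (secantPolarizationClass 𝒥.J hP.isAmple G₁ G₂ (Nat.succ_ne_zero d) h₁ h₂ d θ) := by
    obtain ⟨-, hh⟩ := hq
    rwa [h6] at hh
  have hrat : IsRationalClass θX := by
    rw [hθX]
    exact (isRationalClass_map_iff_of_iso e).2 hq.1
  have hhodge : IsOfHodgeType 6 X 2 1 1 θX := by
    rw [hθX]
    exact (isOfHodgeType_map_iff_of_iso e).2 hq6
  have hne : θX ≠ 0 := by
    rw [hθX]
    intro h0
    apply secantPolarizationClass_ne_zero 𝒥.J hP.isAmple G₁ G₂ (Nat.succ_ne_zero d) h₁ h₂ d hθ.ne_zero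
    apply (complexBetti.bijective_map_of_iso e 2).1
    rw [h0, map_zero]
  exact ⟨hrat, hne, hhodge, lefschetzOneOne_rational_holds hX6 θX hrat hhodge⟩

/-- **Transport along isomorphisms of `ℂ`-schemes**: `(X, θ_X)` is a secant-quotient anchor with its class iff
`(X', f^*θ_X)` is, for `f : X' ≅ X` (compose the chart). [cite: Markman2025SecantWeil, §1.5 (p. 7)] -/
theorem IsSecantQuotientAnchorWith.map_iso (h : IsSecantQuotientAnchorWith d X θX) {X' : SchemeOver ℂ} (f : X' ≅ X) :
    IsSecantQuotientAnchorWith d X' (complexBetti.map f.hom 2 θX) := by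
  obtain ⟨C, hC, 𝒥, h3, Θ, hR, hP, θ, hθ, G₁, G₂, h₁, h₂, hc₁, hn₁, hc₂, hn₂, hbot, e, rfl⟩ := h
  refine ⟨C, hC, 𝒥, h3, Θ, hR, hP, θ, hθ, G₁, G₂, h₁, h₂, hc₁, hn₁, hc₂, hn₂, hbot, f ≪≫ e, ?_⟩
  rw [Iso.trans_hom, complexBetti.map_comp, ModuleCat.comp_apply]

/-! ## §5 The envelope with class is inhabited over the envelope: every `(J × Ĵ)/Ḡ` carries some `h_Y(θ₀)`, `θ₀ ∈ ℚˣ·[Θ]` -/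

/-- **Every secant quotient `(J × Ĵ)/Ḡ` of a Riemann-principally-polarised Jacobian threefold carries Markman's class
`h_Y(θ₀)` for SOME polarisation class `θ₀ ∈ ℚˣ·[Θ]`**, at the identity chart: `Θ` principal ⟹ ample ⟹ `c₁(𝒪(Θ)) ≠ 0`
⟹ `θ₀` exists (`AbelianVariety.IsPrincipalPolarizationDivisor.exists_isPolarizationClassOf`, `dim J = 3 ≥ 1`), and
`isSecantQuotientAnchorWith_map` at `e = Iso.refl`. (The v3.1 anchor clause «`∃ θ₀, IsPolarizationClassOf Θ θ₀ ∧ θ = e^*h_Y(θ₀)`»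
of the ring-2 LEAD is thus MET by a theorem, not a claim, as far as `θ₀` is concerned.)
[cite: Markman2025SecantWeil, §1.5 (p. 7) and §3.2 Cor. 3.2.3] [cite: Lange2023AbelianVarietiesComplex, §2.1.1 (p. 68) and §4.2.1] -/
theorem exists_isPolarizationClassOf_isSecantQuotientAnchorWith_secantQuotient {C : SchemeOver ℂ}
    (hC : IsSmoothProjective 1 C) (𝒥 : Jacobian C) (h3 : 𝒥.J.dim = 3) {Θ : CartierDivisor 𝒥.J.X.left}
    (hR : 𝒥.IsRiemannThetaDivisor Θ) (hP : 𝒥.J.IsPrincipalPolarizationDivisor Θ)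
    {G₁ G₂ : Subgroup (𝒥.J.Points ℂ)} (h₁ : G₁ ≤ 𝒥.J.torsionPoints ℂ (d + 1 : ℕ))
    (h₂ : G₂ ≤ 𝒥.J.torsionPoints ℂ (d + 1 : ℕ)) (hc₁ : IsCyclic G₁) (hn₁ : Nat.card G₁ = d + 1) (hc₂ : IsCyclic G₂)
    (hn₂ : Nat.card G₂ = d + 1) (hbot : G₁ ⊓ G₂ = ⊥) :
    ∃ θ₀ : complexBetti 𝒥.J.X 2, 𝒥.J.IsPolarizationClassOf Θ θ₀ ∧
      IsSecantQuotientAnchorWith d (secantQuotient 𝒥.J hP.isAmple G₁ G₂ (Nat.succ_ne_zero d) h₁ h₂).X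
        (secantPolarizationClass 𝒥.J hP.isAmple G₁ G₂ (Nat.succ_ne_zero d) h₁ h₂ d θ₀) := by
  obtain ⟨θ₀, hθ₀⟩ := hP.exists_isPolarizationClassOf (by omega)
  refine ⟨θ₀, hθ₀, ?_⟩
  have h := isSecantQuotientAnchorWith_map hC 𝒥 h3 hR hP hθ₀ h₁ h₂ hc₁ hn₁ hc₂ hn₂ hbot (Iso.refl _)
  rwa [Iso.refl_hom, complexBetti.map_id] at h

/-- **`IsSecantQuotientSixfold d Y ⟹ ∃ θ_Y, IsSecantQuotientAnchorWith d Y.X θ_Y`**: forgetting the class loses nothing —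
every secant-quotient sixfold carries Markman's polarisation class for some `θ₀ ∈ ℚˣ·[Θ]` (transport `h_Y(θ₀)` along the
scheme isomorphism `Y.X ≅ ((J × Ĵ)/Ḡ).X` underlying the chart, `AbelianVariety.overIsoOfIso`).
[cite: Markman2025SecantWeil, §1.5 (p. 7)] [cite: Lange2023AbelianVarietiesComplex, §2.1.1 (p. 68)] -/
theorem IsSecantQuotientSixfold.exists_isSecantQuotientAnchorWith {Y : AbelianVariety ℂ} (h : IsSecantQuotientSixfold d Y) :
    ∃ θY : complexBetti Y.X 2, IsSecantQuotientAnchorWith d Y.X θY := by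
  obtain ⟨C, hC, 𝒥, h3, Θ, hR, hP, G₁, G₂, h₁, h₂, hc₁, hn₁, hc₂, hn₂, hbot, ⟨e⟩⟩ := h
  obtain ⟨θ₀, hθ₀⟩ := hP.exists_isPolarizationClassOf (by omega)
  exact ⟨_, isSecantQuotientAnchorWith_map hC 𝒥 h3 hR hP hθ₀ h₁ h₂ hc₁ hn₁ hc₂ hn₂ hbot
    (AbelianVariety.overIsoOfIso e)⟩

/-- **The two envelopes agree on abelian varieties**: `IsSecantQuotientSixfold d Y ↔ ∃ θ_Y, IsSecantQuotientAnchorWith d Y.X θ_Y`.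
[cite: Markman2025SecantWeil, §1.5 (p. 7)] -/
theorem isSecantQuotientSixfold_iff_exists_isSecantQuotientAnchorWith {Y : AbelianVariety ℂ} :
    IsSecantQuotientSixfold d Y ↔ ∃ θY : complexBetti Y.X 2, IsSecantQuotientAnchorWith d Y.X θY :=
  ⟨fun h ↦ h.exists_isSecantQuotientAnchorWith, fun ⟨_, h⟩ ↦ h.isSecantQuotientSixfold⟩

/-- For a secant-quotient anchor with class, the SAME `X` is an anchor with class for every other polarisation class of a
(possibly different) witnessing theta divisor rescaled by `q ∈ ℚˣ`: the predicate is `ℚˣ`-saturated in `θ_X`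
(`secantPolarizationClass_smul`, `IsPolarizationClassOf.smul`). [cite: Markman2025SecantWeil, §1.5 (p. 7)]
[cite: Lange2023AbelianVarietiesComplex, §2.1.1 (p. 68)] -/
theorem IsSecantQuotientAnchorWith.smul (h : IsSecantQuotientAnchorWith d X θX) {q : ℚ} (hq : q ≠ 0) :
    IsSecantQuotientAnchorWith d X ((q : ℂ) • θX) := by
  obtain ⟨C, hC, 𝒥, h3, Θ, hR, hP, θ, hθ, G₁, G₂, h₁, h₂, hc₁, hn₁, hc₂, hn₂, hbot, e, rfl⟩ := h
  refine ⟨C, hC, 𝒥, h3, Θ, hR, hP, (q : ℂ) • θ, hθ.smul hq, G₁, G₂, h₁, h₂, hc₁, hn₁, hc₂, hn₂, hbot, e, ?_⟩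
  rw [secantPolarizationClass_smul, map_smul]

end Literature.AlgebraicGeometry.Markman2025

end
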